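import Mathlib
import Summits.Ventures.PercRepro2.LocRows
import Summits.Ventures.PercRepro2.SwRow
import Summits.Ventures.PercRepro2.SwOut
import Summits.Ventures.PercRepro2.SwAllRow
import Summits.Ventures.PercRepro2.SwOutAll
import Summits.Ventures.PercRepro2.SwOutArmFlip
import Summits.Ventures.PercRepro2.SwOutArmThm
import Summits.Ventures.PercRepro2.SwOutCoreDefs
import Summits.Ventures.PercRepro2.SwOutBigBlockDefs
import Summits.Ventures.PercRepro2.SwOutMixedBaseDefs
import Summits.Ventures.PercRepro2.SwOutMixedBaseClasses
import Summits.Ventures.PercRepro2.SwOutMixedBaseHull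
import Summits.Ventures.PercRepro2.SwOutMixedBaseDual
import Summits.Ventures.PercRepro2.SwOutMixedCore
import Summits.Ventures.PercRepro2.SwOutMixedCoreEdgeMap

/-!
# The u–p move of the mixed single junction (blind cell PercRepro2, night-4 g18, 2026-08-27;
proofs/NIGHT4-G18.md §5, item (G3) of NIGHT4-G17.md §4⁗′: the `uP`-moves)

The move `toggleUP` turns the u–p edges from red to blue.  Generic graph lemma
(`mem_cluster_of_removed_at`): removing the open edges between `u` and `p` from a configuration
keeps a vertex `o ≠ u` in the cluster of `l` provided `u` is not in the new cluster of `l` and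
either `p` is not in it either, or every open edge at `u` goes to `p`.  Applied to the red
colourings (red edges removed) and to the blue colourings of the reverse move (blue edges
removed), with the hull formulas for the facts about `u` and `p`, it gives the two block moves
`F(⊤,1,f) = (⊤,1,1,1,f) → D(1,1,f) = (⊤,1,0,1,f)` (`mem_tgtU_toggleUP_top`: `p` sealed to `p`
dropped at every u-arm red) and `D(0,0,f) = (⊥,0,1,0,f) → F(⊥,0,f) = (⊥,0,0,0,f)`
(`mem_tgtU_toggleUP_bot`: `p` red-attached to `p` blue-attached at every u-arm blue).
-/

namespace Summit.Ventures.PercRepro2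

namespace BigBlock

open Hull LocRows

variable {V : Type*} {E : Type*}

section Generic

variable {ends : E → Sym2 V}

/-- A vertex with no open edge is in no cluster but its own. -/
lemma not_mem_cluster_of_no_open_edge {ω : Config E} {l x : V} (hlx : l ≠ x)
    (hx : ∀ e, ω e = true → ∀ y, ends e ≠ s(x, y)) : x ∉ cluster ends ω l := by
  intro hmem
  have key : x ∈ {z : V | z ≠ x} := by
    refine mem_of_conn_of_closed (S := {z : V | z ≠ x}) ?_ hlx hmem
    intro a ha b hab
    obtain ⟨_, e, he, hends⟩ := openGraph_adj.1 hab
    intro hbx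
    rw [hbx] at hends
    exact hx e he a (ends_swap hends)
  exact key rfl

/-- A vertex of the cluster of `h` is not in the cluster of `l` when `l` is not in the cluster of
`h`. -/
lemma not_mem_cluster_of_mem_cluster {ω : Config E} {l x h : V} (hx : x ∈ cluster ends ω h)
    (hl : l ∉ cluster ends ω h) : x ∉ cluster ends ω l := by
  intro hmem
  exact hl (SimpleGraph.Reachable.trans hx (conn_symm hmem))

/-- **Removing the open edges between `u` and `p`** keeps `o ≠ u` in the cluster of `l` when `u` is
not in the new cluster and either `p` is not in it or every open edge at `u` goes to `p`. -/
lemma mem_cluster_of_removed_at {ω ω' : Config E} {l u p o : V}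
    (hD : ∀ e, ω e = true → ω' e = false → ends e = s(u, p))
    (hu : u ∉ cluster ends ω' l)
    (hcase : p ∉ cluster ends ω' l ∨ ∀ e, ω e = true → ∀ y, ends e = s(u, y) → y = p)
    (hou : o ≠ u) (ho : o ∈ cluster ends ω l) : o ∈ cluster ends ω' l := by
  by_cases hp : p ∈ cluster ends ω' l
  · rcases hcase with hcase | hcase
    · exact absurd hp hcase
    · have key : o ∈ cluster ends ω' l ∪ {u} := by
        refine mem_of_conn_of_closed (S := cluster ends ω' l ∪ {u}) ?_
          (Or.inl (mem_cluster_self _ _ _)) ho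
        rintro a (ha | ha) b hab
        · obtain ⟨_, e, he, hends⟩ := openGraph_adj.1 hab
          by_cases he' : ω' e = true
          · exact Or.inl (mem_cluster_of_edge ha he' hends)
          · have hup := hD e he (by simpa using he')
            rw [hup, Sym2.eq_iff] at hends
            rcases hends with ⟨rfl, _⟩ | ⟨rfl, rfl⟩
            · exact absurd ha hu
            · exact Or.inr rfl
        · rw [Set.mem_singleton_iff] at ha
          subst ha
          obtain ⟨_, e, he, hends⟩ := openGraph_adj.1 hab
          rw [hcase e he b hends]
          exact Or.inl hp
      rcases key with key | key
      · exact key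
      · exact absurd key hou
  · refine mem_of_conn_of_closed (S := cluster ends ω' l) ?_ (mem_cluster_self _ _ _) ho
    intro a ha b hab
    obtain ⟨_, e, he, hends⟩ := openGraph_adj.1 hab
    by_cases he' : ω' e = true
    · exact mem_cluster_of_edge ha he' hends
    · have hup := hD e he (by simpa using he')
      rw [hup, Sym2.eq_iff] at hends
      rcases hends with ⟨rfl, _⟩ | ⟨_, rfl⟩
      · exact absurd ha hu
      · exact absurd ha hp

/-- Membership in the target side of the conditioning, unpacked. -/
lemma mem_tgtU_iff' [Fintype E] [DecidableEq E] {ζ : Config E} {l h o : V} :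
    ζ ∈ tgtU ends l h {S : Set V | o ∈ S} ↔
      (h ∉ cluster ends ζ l ∧ h ∉ cluster ends (blue ζ) l) ∧ o ∈ cluster ends ζ l ∧
        o ∉ cluster ends (blue ζ) l := by
  simp only [tgtU, Finset.mem_filter, Finset.mem_univ, true_and, Set.mem_setOf_eq, hull,
    Set.mem_union, not_or]

end Generic

section MoveUP

variable {ι κ : Type*}

/-- The move toggling the u–p edges. -/
def toggleUP (q : Pt ι κ) : Pt ι κ := (q.1, q.2.1, !q.2.2.1, q.2.2.2.1, q.2.2.2.2)

variable {ends : E → Sym2 V} {σ : Config E} {h u p : V} {U : ι → Set V} {Ah : Set V}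
  {F : κ → Set V} (hb : MixedBase ends σ h u p U Ah F)
include hb

omit hb in
/-- Off the u–p edges, the move `toggleUP` changes nothing. -/
lemma mixedReal_toggleUP_of_notMem {q : Pt ι κ} {e : E} (he : e ∉ clsUP ends u p) :
    mixedReal ends u p U Ah F σ (toggleUP q) e = mixedReal ends u p U Ah F σ q e := by
  have key : e ∈ flipSet ends u p U Ah F (toggleUP q) ↔ e ∈ flipSet ends u p U Ah F q := by
    simp only [flipSet, toggleUP, Set.mem_union, Set.mem_setOf_eq, he, and_false, or_false]
  unfold mixedReal
  by_cases hf : e ∈ flipSet ends u p U Ah F q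
  · rw [if_pos (key.2 hf), if_pos hf]
  · rw [if_neg (fun h' => hf (key.1 h')), if_neg hf]

/-- On a u–p edge at `uP = true`, the realisation is red. -/
lemma MixedBase.mixedReal_UP_red {q : Pt ι κ} (huP : q.2.2.1 = true) {e : E}
    (he : e ∈ clsUP ends u p) : mixedReal ends u p U Ah F σ q e = true := by
  rw [hb.mixedReal_apply_UP he, if_pos huP]
  exact hb.u_red e p he

/-- On a u–p edge at `uP = false`, the realisation is blue. -/
lemma MixedBase.mixedReal_UP_blue {q : Pt ι κ} (huP : q.2.2.1 = false) {e : E}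
    (he : e ∈ clsUP ends u p) : mixedReal ends u p U Ah F σ q e = false := by
  rw [hb.mixedReal_apply_UP he, if_neg (by simp [huP]), hb.u_red e p he]
  rfl

/-- **The move `toggleUP` from `uP = true` only removes red edges**, the u–p edges. -/
lemma MixedBase.toggleUP_le {q : Pt ι κ} (huP : q.2.2.1 = true) :
    mixedReal ends u p U Ah F σ (toggleUP q) ≤ mixedReal ends u p U Ah F σ q := by
  intro e
  by_cases hx : e ∈ clsUP ends u p
  · rw [hb.mixedReal_UP_blue (q := toggleUP q) (by simp [toggleUP, huP]) hx]
    exact Bool.false_le _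
  · rw [mixedReal_toggleUP_of_notMem hx]

omit hb in
/-- The edges where `toggleUP` (from `uP = true`) changes the colour are u–p edges. -/
lemma toggleUP_diff {q : Pt ι κ} (_huP : q.2.2.1 = true) (e : E)
    (_h1 : mixedReal ends u p U Ah F σ q e = true)
    (h2 : mixedReal ends u p U Ah F σ (toggleUP q) e = false) : ends e = s(u, p) := by
  by_contra hx
  rw [mixedReal_toggleUP_of_notMem hx] at h2
  rw [_h1] at h2
  exact absurd h2 (by decide)

/-- An edge at `u` of the realisation is a u–p edge or an edge into a u-arm, coloured as the arm. -/
lemma MixedBase.edge_at_u {q : Pt ι κ} {e : E} {y : V} (hends : ends e = s(u, y))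
    (hy : y ≠ p) : ∃ j, y ∈ U j ∧ mixedReal ends u p U Ah F σ q e = q.1 j := by
  rcases hb.u_edges e y hends with ⟨j, hj⟩ | rfl
  · refine ⟨j, hj, ?_⟩
    rw [hb.mixedReal_apply_U ⟨y, hj, u, ends_swap hends⟩, hb.u_red e y hends]
    cases q.1 j <;> rfl
  · exact absurd rfl hy

omit hb in
/-- The blue colourings of the move: the differences are u–p edges. -/
lemma toggleUP_diff_blue {q : Pt ι κ} (huP : q.2.2.1 = true) (e : E)
    (h1 : blue (mixedReal ends u p U Ah F σ (toggleUP q)) e = true)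
    (h2 : blue (mixedReal ends u p U Ah F σ q) e = false) : ends e = s(u, p) := by
  simp only [blue, Bool.not_eq_true', Bool.not_eq_false'] at h1 h2
  exact toggleUP_diff huP e h2 h1

/-- At a point with `p` sealed (`uP = true`, `a = true`, `e = true`) and every u-arm red, `p` has no
open edge after the move: the u–p edges are now blue, the dead and outside edges blue at the base. -/
lemma MixedBase.p_isolated_top {q : Pt ι κ} (ha : q.2.1 = true) (huP : q.2.2.1 = true)
    (he : q.2.2.2.1 = true) {e : E}
    (hred : mixedReal ends u p U Ah F σ (toggleUP q) e = true) (y : V) (hends : ends e = s(p, y)) :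
    False := by
  have ha' : (toggleUP q).2.1 = true := ha
  have he' : (toggleUP q).2.2.2.1 = true := he
  by_cases hyu : y = u
  · rw [hyu] at hends
    rw [hb.mixedReal_UP_blue (q := toggleUP q) (by simp [toggleUP, huP]) (ends_swap hends)] at hred
    exact absurd hred (by decide)
  rcases hb.p_edges e y hends with hyu' | hyA | ⟨_, _, hout⟩
  · exact hyu hyu'
  · rw [hb.mixedReal_apply_Ah ⟨y, hyA, p, ends_swap hends⟩, if_pos ha',
      hb.dead_blue e y hends hyA] at hred
    exact absurd hred (by decide)
  · have hx : e ∈ clsExt ends u p Ah := ⟨y, hends, hyu, fun hyA => hout (Or.inl (Or.inr hyA))⟩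
    rw [hb.mixedReal_apply_Ext hx, if_pos he', hb.ext_blue e y hends hyu
      (fun hyA => hout (Or.inl (Or.inr hyA)))] at hred
    exact absurd hred (by decide)

/-- At a point with `p` red-attached, the h-piece blue and the outside edges red (`uP = true`,
`a = false`, `e = false`), `p` has no blue edge. -/
lemma MixedBase.p_isolated_blue_bot {q : Pt ι κ} (ha : q.2.1 = false) (huP : q.2.2.1 = true)
    (he : q.2.2.2.1 = false) {e : E} (hblue : mixedReal ends u p U Ah F σ q e = false) (y : V)
    (hends : ends e = s(p, y)) : False := by
  by_cases hyu : y = u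
  · rw [hyu] at hends
    rw [hb.mixedReal_UP_red huP (ends_swap hends)] at hblue
    exact absurd hblue (by decide)
  rcases hb.p_edges e y hends with hyu' | hyA | ⟨_, _, hout⟩
  · exact hyu hyu'
  · rw [hb.mixedReal_apply_Ah ⟨y, hyA, p, ends_swap hends⟩, if_neg (by simp [ha]),
      hb.dead_blue e y hends hyA] at hblue
    exact absurd hblue (by decide)
  · have hx : e ∈ clsExt ends u p Ah := ⟨y, hends, hyu, fun hyA => hout (Or.inl (Or.inr hyA))⟩
    rw [hb.mixedReal_apply_Ext hx, if_neg (by simp [he]), hb.ext_blue e y hends hyu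
      (fun hyA => hout (Or.inl (Or.inr hyA)))] at hblue
    exact absurd hblue (by decide)

/-- **The u–p move keeps the conditioning at `p` sealed with every u-arm red**:
`(⊤, 1, 1, 1, f) → (⊤, 1, 0, 1, f)`. -/
theorem MixedBase.mem_tgtU_toggleUP_top [Fintype E] [DecidableEq E] [Nonempty ι]
    (hup : ∃ e, ends e = s(u, p)) {Us : Set V} {l o : V}
    (hUs : {h} ∪ {u} ∪ {p} ∪ armsAll U Ah F ⊆ Us) (hl : l ∉ Us) (hou : o ≠ u) {q : Pt ι κ}
    (hs : ∀ j, q.1 j = true) (ha : q.2.1 = true) (huP : q.2.2.1 = true) (he : q.2.2.2.1 = true)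
    (hQ : mixedReal ends u p U Ah F σ q ∈ tgtU ends l h {S : Set V | o ∈ S}) :
    mixedReal ends u p U Ah F σ (toggleUP q) ∈ tgtU ends l h {S : Set V | o ∈ S} := by
  obtain ⟨j₀⟩ := (inferInstance : Nonempty ι)
  have hqR' : ¬ LeakR (toggleUP q) := by
    rintro ⟨_, h2, _⟩
    simp [toggleUP, huP] at h2
  have hqB' : ¬ LeakB (toggleUP q) := by
    rintro ⟨⟨j, hj⟩, _, _⟩
    simp [toggleUP, flipPt, flipAll, hs j] at hj
  have hlh : l ∉ hull ends (mixedReal ends u p U Ah F σ (toggleUP q)) h :=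
    fun hl' => hl (hUs (hb.hull_mixedReal_subset hup hqR' hqB' hl'))
  have hlu : l ≠ u := fun hlu => hl (hUs (hlu ▸ Or.inl (Or.inl (Or.inr rfl))))
  have hlp : l ≠ p := fun hlp => hl (hUs (hlp ▸ Or.inl (Or.inr rfl)))
  rw [mem_tgtU_iff'] at hQ ⊢
  obtain ⟨_, hoA, hoB⟩ := hQ
  refine ⟨⟨fun hh => hlh (Or.inl (conn_symm hh)), fun hh => hlh (Or.inr (conn_symm hh))⟩, ?_, ?_⟩
  · -- the red side: `u` and `p` are not in the new red cluster of `l`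
    refine mem_cluster_of_removed_at (toggleUP_diff huP) ?_ (Or.inl ?_) hou hoA
    · refine not_mem_cluster_of_mem_cluster (h := h) ?_ (fun hl' => hlh (Or.inl hl'))
      rw [hb.cluster_mixedReal hup hqR']
      exact hb.mem_redSetM_u.2 ⟨j₀, hs j₀⟩
    · exact not_mem_cluster_of_no_open_edge hlp
        (fun e hred y hends => hb.p_isolated_top ha huP he hred y hends)
  · -- the blue side: the reverse move removes the blue u–p edges; `u` has no blue edge before
    intro ho'
    refine hoB (mem_cluster_of_removed_at (toggleUP_diff_blue huP) ?_ (Or.inr ?_) hou ho')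
    · refine not_mem_cluster_of_no_open_edge hlu (fun e hb' y hends => ?_)
      simp only [blue, Bool.not_eq_true'] at hb'
      by_cases hyp : y = p
      · subst hyp
        rw [hb.mixedReal_UP_red huP hends] at hb'
        exact absurd hb' (by decide)
      · obtain ⟨j, _, hcol⟩ := hb.edge_at_u (q := q) hends hyp
        rw [hcol, hs j] at hb'
        exact absurd hb' (by decide)
    · intro e hb' y hends
      simp only [blue, Bool.not_eq_true'] at hb'
      by_contra hyp
      obtain ⟨j, _, hcol⟩ := hb.edge_at_u (q := toggleUP q) hends hyp
      rw [hcol] at hb'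
      simp [toggleUP, hs j] at hb'

/-- **The u–p move keeps the conditioning at `p` red-attached with every u-arm blue, the h-piece
blue and the outside edges red**: `(⊥, 0, 1, 0, f) → (⊥, 0, 0, 0, f)`. -/
theorem MixedBase.mem_tgtU_toggleUP_bot [Fintype E] [DecidableEq E] [Nonempty ι]
    (hup : ∃ e, ends e = s(u, p)) {Us : Set V} {l o : V}
    (hUs : {h} ∪ {u} ∪ {p} ∪ armsAll U Ah F ⊆ Us) (hl : l ∉ Us) (hou : o ≠ u) {q : Pt ι κ}
    (hs : ∀ j, q.1 j = false) (ha : q.2.1 = false) (huP : q.2.2.1 = true) (he : q.2.2.2.1 = false)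
    (hQ : mixedReal ends u p U Ah F σ q ∈ tgtU ends l h {S : Set V | o ∈ S}) :
    mixedReal ends u p U Ah F σ (toggleUP q) ∈ tgtU ends l h {S : Set V | o ∈ S} := by
  obtain ⟨j₀⟩ := (inferInstance : Nonempty ι)
  have hqR' : ¬ LeakR (toggleUP q) := by
    rintro ⟨⟨j, hj⟩, _, _⟩
    simp [toggleUP, hs j] at hj
  have hqB' : ¬ LeakB (toggleUP q) := by
    rintro ⟨_, _, h3 | h3⟩
    · simp [toggleUP, flipPt, he] at h3
    · simp [toggleUP, flipPt, ha] at h3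
  have hqB : ¬ LeakB q := by
    rintro ⟨_, h2, _⟩
    simp [flipPt, huP] at h2
  have hlh : l ∉ hull ends (mixedReal ends u p U Ah F σ (toggleUP q)) h :=
    fun hl' => hl (hUs (hb.hull_mixedReal_subset hup hqR' hqB' hl'))
  have hlu : l ≠ u := fun hlu => hl (hUs (hlu ▸ Or.inl (Or.inl (Or.inr rfl))))
  have hlp : l ≠ p := fun hlp => hl (hUs (hlp ▸ Or.inl (Or.inr rfl)))
  rw [mem_tgtU_iff'] at hQ ⊢
  obtain ⟨_, hoA, hoB⟩ := hQ
  refine ⟨⟨fun hh => hlh (Or.inl (conn_symm hh)), fun hh => hlh (Or.inr (conn_symm hh))⟩, ?_, ?_⟩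
  · -- the red side: `u` has no red edge after the move, every red edge at `u` before went to `p`
    refine mem_cluster_of_removed_at (toggleUP_diff huP) ?_ (Or.inr ?_) hou hoA
    · refine not_mem_cluster_of_no_open_edge hlu (fun e hred y hends => ?_)
      by_cases hyp : y = p
      · subst hyp
        rw [hb.mixedReal_UP_blue (q := toggleUP q) (by simp [toggleUP, huP]) hends] at hred
        exact absurd hred (by decide)
      · obtain ⟨j, _, hcol⟩ := hb.edge_at_u (q := toggleUP q) hends hyp
        rw [hcol] at hred
        simp [toggleUP, hs j] at hred
    · intro e hred y hends
      by_contra hyp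
      obtain ⟨j, _, hcol⟩ := hb.edge_at_u (q := q) hends hyp
      rw [hcol, hs j] at hred
      exact absurd hred (by decide)
  · -- the blue side: `u` is in the blue cluster of `h`, `p` has no blue edge before the move
    intro ho'
    refine hoB (mem_cluster_of_removed_at (toggleUP_diff_blue huP) ?_ (Or.inl ?_) hou ho')
    · refine not_mem_cluster_of_mem_cluster (h := h) ?_ ?_
      · rw [hb.cluster_blue_mixedReal hup hqB]
        exact hb.mem_redSetM_u.2 ⟨j₀, by simp [flipPt, flipAll, hs j₀]⟩
      · intro hl'
        have hqR : ¬ LeakR q := by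
          rintro ⟨⟨j, hj⟩, _, _⟩
          rw [hs j] at hj
          exact absurd hj (by decide)
        exact hl (hUs (hb.hull_mixedReal_subset hup hqR hqB (Or.inr hl')))
    · exact not_mem_cluster_of_no_open_edge hlp (fun e hb' y hends => by
        simp only [blue, Bool.not_eq_true'] at hb'
        exact hb.p_isolated_blue_bot ha huP he hb' y hends)

end MoveUP

end BigBlock

end Summit.Ventures.PercRepro2
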